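import Summits.BirchSwinnertonDyer.BirchSwinnertonDyer.Theorems.KimAtThreeShallowEqDeepOffStratumOfDefinedKatoFinal
import Summits.BirchSwinnertonDyer.BirchSwinnertonDyer.Theorems.KimAtThreeDeepUpperPortSharedOfFineKato
import HarnessLib

/-!
# Route `KimAtThreeKolyvagin` (W2): crux 19560 `KatoKuriharaPortThreeShared` BY NAME from the φ-level DEFINED-KATO package with
# the EXACT compatibility (`b = 0`) on the Kato stratum, and crux 19077 `ShallowEqDeepAtTorsionFree` BY NAME from the four
# published leaves + the four defined-Kato packages ALONE (19560 DERIVED, not displayed)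

Cell `bsd-addord`, seat `bsd-addord-w2-c4` (gen 10; OWNER of crux 19599 `ShallowEqDeepOffKatoStratum`, item 19077
`ShallowEqDeepAtTorsionFree`).  `--supports` 19077.  HONEST FRAMING: END THEOREMS WITH DISPLAYED HYPOTHESES (no definition,
no named fact, no instance, no `sorry`); CONDITIONAL on displayed construction-shaped packages; nothing closed, nothing booked;
19560 / 19599 / 19077 stay OPEN; BSD is not proved by any of this.  19560 is seat kim3's (LEAD, line hKloc): §2 is OFFERED to it.

## What
§1 `katoExpStarFiniteLevelAt_of_rider₂_zero` (n1011's exponent-0 rider ⟸ (Λ)-clauses ∧ RIDER₂ at (0,0)); §2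
`fineKato_of_definedKatoExact_katoStratum` ((C1ₑₓ⁰ᵘ) ⟹ kim3's (C1) on a Kato-stratum row: `φ = 3^{v₃(c₃)}φ′ = φ′`,
`rider₂_of_compat` at `(0,0,0)`) and **`katoKuriharaPortThreeShared_of_definedKatoExact : (C1ₑₓ⁰ᵘ)[additive, 3 ∤ c_P] → 19560`**
(w2-c3's `katoKuriharaPortThreeShared_of_fineKato`); §3 **`shallowEqDeepAtTorsionFree_of_leaves_of_definedKato_noPort`**:
19077 BY NAME ⟸ 4 leaves ∧ (C1ₑₓ¹ᵘ)[mult] ∧ (C1ₑₓ^τ)[good] ∧ (C1ₑₓ⁰ᵘ)[additive, 3 ∤ c_P] ∧ (C1₂)[Manin] — NO crux hypothesis.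
References: [BlochKato1990] §3; [Kato2004Asterisque] §9.4, Thm. 9.7; [Kim2022StructureSelmer] §3.2.3, Thm. 3.13; memo W2C4-MULT-TWOEXP-g10 §9.
-/

set_option autoImplicit false
-- the Theorems namespace of a single-conjunct summit repeats the summit name by design (D-0017)
set_option linter.dupNamespace false

noncomputable section

open scoped NumberField TensorProduct ContRepresentation Classical
open CategoryTheory Field Function Finset IsDedekindDomain NumberField WeierstrassCurve
open Rat.HeightOneSpectrum
open Literature.NumberTheory.GaloisRepresentations Literature.NumberTheory.GaloisCohomology
open Literature.NumberTheory.GaloisRepresentations.DiscreteGaloisModule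
open Literature.NumberTheory.EllipticCurves Literature.NumberTheory.EllipticCurves.ModularForms
open Literature.NumberTheory.EllipticCurves.Rank1Residual
open Literature.NumberTheory.EllipticCurves.Kato2004
open Literature.NumberTheory.EllipticCurves.Kato2004.EulerSystemValues
open Summit.BirchSwinnertonDyer.Rank1Residual.GaloisImage
open Summit.BirchSwinnertonDyer.Rank1Residual.Additive.LocalLog
open Summit.BirchSwinnertonDyer.BirchSwinnertonDyer.Theses.KimAtThreeKolyvagin
open Summit.BirchSwinnertonDyer.BirchSwinnertonDyer.Theorems
open Summit.BirchSwinnertonDyer.BirchSwinnertonDyer.Theorems.KimAtThreeKolyvaginDefs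
open Summit.BirchSwinnertonDyer.BirchSwinnertonDyer.Theorems.KimAtThreeShallowEqDeepSplitGlueNoStub
open Summit.BirchSwinnertonDyer.BirchSwinnertonDyer.Theorems.KimAtThreeDeepUpperLocalLatticeUniform
open Summit.BirchSwinnertonDyer.BirchSwinnertonDyer.Theorems.KimAtThreeDeepUpperRiderOfCompat
open Summit.BirchSwinnertonDyer.BirchSwinnertonDyer.Theorems.KimAtThreeShallowEqDeepDefectOfDefinedKato
open Summit.BirchSwinnertonDyer.BirchSwinnertonDyer.Theorems.KimAtThreeShallowEqDeepOffStratumOfDefinedKatoFinal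

namespace Summit.BirchSwinnertonDyer.BirchSwinnertonDyer.Theorems.KimAtThreeShallowEqDeepKatoStratumOfDefinedKato

/-- Local notation: the TWO-EXPONENT rider clause (ii₂) at depth `j`, torsion slot `t`, defect exponent `e`,
place `v`, for the pair `(Λ, Λf)` (seat acc6's RIDER₂, VERBATIM). -/
local notation3 (prettyPrint := false) "RIDER₂⟦" W' ", " j ", " t' ", " e' ", " v' ", " Λ' ", " Λf "⟧" =>
  ∀ (r : Finset (HeightOneSpectrum (𝓞 ℚ)))
    (Ψ : H1 (tateRep W' 3) (cycSubgroup 3 0 r) →+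
      continuousCohomology 1
        (subgroupRep (WeierstrassCurve.torsionGaloisModule W' (((3 : ℕ) : ℤ) ^ j * ((3 : ℕ) : ℤ))).toTopRep
          (cycSubgroup 3 0 r))),
    (∀ (φ : contOneCocycles (subgroupRep (tateRep W' 3).toTopRep (cycSubgroup 3 0 r)))
        (ψ : contOneCocycles
          (subgroupRep (WeierstrassCurve.torsionGaloisModule W' (((3 : ℕ) : ℤ) ^ j * ((3 : ℕ) : ℤ))).toTopRep
            (cycSubgroup 3 0 r))),
        (∀ g, ((ψ.1 g : geomTorsion W' (((3 : ℕ) : ℤ) ^ j * ((3 : ℕ) : ℤ))) : geomPoints W') =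
          TateModule.proj 3 (j + 1) (φ.1 g)) →
        Ψ (oneCocycleClass _ φ) = oneCocycleClass _ ψ) →
    ∀ (y : H1 (tateRep W' 3) (cycSubgroup 3 0 r))
      (κ₀ : galoisCohomology (WeierstrassCurve.torsionGaloisModule W' (((3 : ℕ) : ℤ) ^ j * ((3 : ℕ) : ℤ))) 1)
      (s : ℤ_[3]),
      resSubgroup (WeierstrassCurve.torsionGaloisModule W' (((3 : ℕ) : ℤ) ^ j * ((3 : ℕ) : ℤ))).toTopRep
          (cycSubgroup 3 0 r) 1 κ₀ = Ψ y →
      galoisCohomology.localization (WeierstrassCurve.torsionGaloisModule W' (((3 : ℕ) : ℤ) ^ j * ((3 : ℕ) : ℤ)))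
          (Sum.inr v') 1 κ₀ ∈ propagatedSelmerStructure W' 3 j (Sum.inr v') →
      (∃ l ∈ cycIntLattice 3 (cycLevel 3 0 r),
          (((3 : ℕ) : ℤ_[3]) ^ t') • Λ' 0 r y - ((s : ℚ_[3]) ⊗ₜ[ℚ] (1 : CyclotomicField (cycLevel 3 0 r) ℚ)) =
            (((3 : ℕ) : ℤ_[3]) ^ (j + 1)) • (l : ℚ_[3] ⊗[ℚ] CyclotomicField (cycLevel 3 0 r) ℚ)) →
      ((3 ^ e' : ℕ) : ZMod (3 ^ (j + 1))) *
        Λf (galoisCohomology.localization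
          (WeierstrassCurve.torsionGaloisModule W' (((3 : ℕ) : ℤ) ^ j * ((3 : ℕ) : ℤ))) (Sum.inr v') 1 κ₀) =
        PadicInt.toZModPow (j + 1) s

/-- Local notation: the (Λ)-clauses of DICT3 for the finite-level functional `Λf j` at `v` (onto `ℤ/3^{j+1}` on
`𝓕_can(v)`, kernel the Kummer part). -/
local notation3 (prettyPrint := false) "LAMBDA⟦" W' ", " v' ", " Λf "⟧" =>
  ∀ j : ℕ,
    (∀ c : ZMod (3 ^ (j + 1)), ∃ x ∈ propagatedSelmerStructure W' 3 j (Sum.inr v'), Λf j x = c) ∧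
    (∀ x ∈ propagatedSelmerStructure W' 3 j (Sum.inr v'),
      Λf j x = 0 ↔ x ∈ WeierstrassCurve.kummerSelmerStructure W' (((3 : ℕ) : ℤ) ^ j * ((3 : ℕ) : ℤ)) (Sum.inr v'))

/-- Local notation: Kato's `ZetaBody` FAMILY for `(ι, κK, Λ)` and the cusp form `f'` at level `N'`. -/
local notation3 (prettyPrint := false) "ZBODY⟦" W' ", " N' ", " f' ", " ι' ", " κ' ", " Λ' "⟧" =>
  ∀ (c d a : ℤ) (A : ℕ), 0 < A → Int.gcd c (6 * 3 * A) = 1 → Int.gcd d (6 * 3 * N') = 1 →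
    ∃ (z : ∀ (k' : ℕ) (r : (cyclotomicLevelsRat 3 (badPlaces c d A N')).Ideals),
          H1 (tateRep W' 3) ((cyclotomicLevelsRat 3 (badPlaces c d A N')).level k' r.1))
      (x : ∀ (k' : ℕ) (r : (cyclotomicLevelsRat 3 (badPlaces c d A N')).Ideals),
          CyclotomicField (cycLevel 3 k' r.1) ℚ),
      ZetaBody W' 3 f' ι' κ' Λ' c d a A z x

/-- Local notation: the TWISTED compatibility COMPAT_τ at depth `j` between `Λ_{0,r}` and `φ` (place `v`, model
`t₃`): «`3•(φ(h) ⊗ 1 − Λ_{0,r}(y)) ∈ 3^{j+1}·Tw_{P_w} L_int`» for every `T`-lift `h` of `loc_v κ₀`, `res κ₀ = Ψ y`,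
and every `w` with `w·[3] = 1`. -/
local notation3 (prettyPrint := false) "COMPATτ⟦" W' ", " j ", " v' ", " t3 ", " Λ' ", " φ0 "⟧" =>
  ∀ (r : Finset (HeightOneSpectrum (𝓞 ℚ))) (w : (ZMod (cycLevel 3 0 r))ˣ),
    (w : ZMod (cycLevel 3 0 r)) * ((3 : ℕ) : ZMod (cycLevel 3 0 r)) = 1 →
    ∀ (Ψ : H1 (tateRep W' 3) (cycSubgroup 3 0 r) →+
      continuousCohomology 1 (subgroupRep
        (WeierstrassCurve.torsionGaloisModule W' (((3 : ℕ) : ℤ) ^ j * ((3 : ℕ) : ℤ))).toTopRep (cycSubgroup 3 0 r))),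
    (∀ (φ₁ : contOneCocycles (subgroupRep (tateRep W' 3).toTopRep (cycSubgroup 3 0 r)))
        (ψ : contOneCocycles (subgroupRep
          (WeierstrassCurve.torsionGaloisModule W' (((3 : ℕ) : ℤ) ^ j * ((3 : ℕ) : ℤ))).toTopRep (cycSubgroup 3 0 r))),
        (∀ g, ((ψ.1 g : geomTorsion W' (((3 : ℕ) : ℤ) ^ j * ((3 : ℕ) : ℤ))) : geomPoints W') =
          TateModule.proj 3 (j + 1) (φ₁.1 g)) →
        Ψ (oneCocycleClass _ φ₁) = oneCocycleClass _ ψ) →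
    ∀ (y : H1 (tateRep W' 3) (cycSubgroup 3 0 r))
      (κ₀ : galoisCohomology (WeierstrassCurve.torsionGaloisModule W' (((3 : ℕ) : ℤ) ^ j * ((3 : ℕ) : ℤ))) 1)
      (h : (tateLocalRep W' 3 (Sum.inr v')).cohomology 1),
      resSubgroup (WeierstrassCurve.torsionGaloisModule W' (((3 : ℕ) : ℤ) ^ j * ((3 : ℕ) : ℤ))).toTopRep
          (cycSubgroup 3 0 r) 1 κ₀ = Ψ y →
      galoisCohomology.localization (WeierstrassCurve.torsionGaloisModule W' (((3 : ℕ) : ℤ) ^ j * ((3 : ℕ) : ℤ)))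
          (Sum.inr v') 1 κ₀ = tateLocalMap W' 3 j (Sum.inr v') h →
      ∃ l ∈ cycIntLattice 3 (cycLevel 3 0 r),
        ((3 : ℕ) : ℤ_[3]) • ((φ0 h ⊗ₜ[ℚ] (1 : CyclotomicField (cycLevel 3 0 r) ℚ)) - Λ' 0 r y) =
          ((3 : ℤ_[3]) ^ (j + 1)) • ∑ g : (ZMod (cycLevel 3 0 r))ˣ,
            ((((((3 : ℕ) : MonoidAlgebra ℤ_[3] (ZMod (cycLevel 3 0 r))ˣ)) -
                MonoidAlgebra.single w (t3 : ℤ_[3]) +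
                MonoidAlgebra.single (w ^ 2) (1 : ℤ_[3])).coeff g : ℤ_[3]) : ℚ_[3]) •
              Algebra.TensorProduct.map (AlgHom.id ℚ ℚ_[3])
                (sigma (cycLevel 3 0 r) g : CyclotomicField (cycLevel 3 0 r) ℚ →ₐ[ℚ]
                  CyclotomicField (cycLevel 3 0 r) ℚ) l

/-- Local notation: the crude compatibility X1-int at depth `j` WITH EXPONENT `b := 1` between Kato's value datum
`Λ_{0,r}` and the scalar dual exponential `φ` at `v` (seat w2-c3's X1-int_b text with `b = 1`). -/
local notation3 (prettyPrint := false) "COMPAT₁⟦" W' ", " j ", " v' ", " Λ' ", " φ0 "⟧" =>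
  ∀ (r : Finset (HeightOneSpectrum (𝓞 ℚ)))
    (Ψ : H1 (tateRep W' 3) (cycSubgroup 3 0 r) →+
      continuousCohomology 1 (subgroupRep
        (WeierstrassCurve.torsionGaloisModule W' (((3 : ℕ) : ℤ) ^ j * ((3 : ℕ) : ℤ))).toTopRep (cycSubgroup 3 0 r))),
    (∀ (φ₁ : contOneCocycles (subgroupRep (tateRep W' 3).toTopRep (cycSubgroup 3 0 r)))
        (ψ : contOneCocycles (subgroupRep
          (WeierstrassCurve.torsionGaloisModule W' (((3 : ℕ) : ℤ) ^ j * ((3 : ℕ) : ℤ))).toTopRep (cycSubgroup 3 0 r))),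
        (∀ g, ((ψ.1 g : geomTorsion W' (((3 : ℕ) : ℤ) ^ j * ((3 : ℕ) : ℤ))) : geomPoints W') =
          TateModule.proj 3 (j + 1) (φ₁.1 g)) →
        Ψ (oneCocycleClass _ φ₁) = oneCocycleClass _ ψ) →
    ∀ (y : H1 (tateRep W' 3) (cycSubgroup 3 0 r))
      (κ₀ : galoisCohomology (WeierstrassCurve.torsionGaloisModule W' (((3 : ℕ) : ℤ) ^ j * ((3 : ℕ) : ℤ))) 1)
      (h : (tateLocalRep W' 3 (Sum.inr v')).cohomology 1),
      resSubgroup (WeierstrassCurve.torsionGaloisModule W' (((3 : ℕ) : ℤ) ^ j * ((3 : ℕ) : ℤ))).toTopRep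
          (cycSubgroup 3 0 r) 1 κ₀ = Ψ y →
      galoisCohomology.localization (WeierstrassCurve.torsionGaloisModule W' (((3 : ℕ) : ℤ) ^ j * ((3 : ℕ) : ℤ)))
          (Sum.inr v') 1 κ₀ = tateLocalMap W' 3 j (Sum.inr v') h →
      ∃ l ∈ cycIntLattice 3 (cycLevel 3 0 r),
        (((3 : ℕ) : ℤ_[3]) ^ (1 : ℕ)) • ((φ0 h ⊗ₜ[ℚ] (1 : CyclotomicField (cycLevel 3 0 r) ℚ)) - Λ' 0 r y) =
          (((3 : ℕ) : ℤ_[3]) ^ (j + 1)) • (l : ℚ_[3] ⊗[ℚ] CyclotomicField (cycLevel 3 0 r) ℚ)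

/-- Local notation: seat w2-c3's crude compatibility at depth `j` with EXACT exponent `b = 0`:
«`φ(h) ⊗ 1 − Λ_{0,r}(y) ∈ 3^{j+1}·L_int`». -/
local notation3 (prettyPrint := false) "COMPAT₀⟦" W' ", " j ", " v' ", " Λ' ", " φ0 "⟧" =>
  ∀ (r : Finset (HeightOneSpectrum (𝓞 ℚ)))
    (Ψ : H1 (tateRep W' 3) (cycSubgroup 3 0 r) →+
      continuousCohomology 1 (subgroupRep
        (WeierstrassCurve.torsionGaloisModule W' (((3 : ℕ) : ℤ) ^ j * ((3 : ℕ) : ℤ))).toTopRep (cycSubgroup 3 0 r))),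
    (∀ (φ₁ : contOneCocycles (subgroupRep (tateRep W' 3).toTopRep (cycSubgroup 3 0 r)))
        (ψ : contOneCocycles (subgroupRep
          (WeierstrassCurve.torsionGaloisModule W' (((3 : ℕ) : ℤ) ^ j * ((3 : ℕ) : ℤ))).toTopRep (cycSubgroup 3 0 r))),
        (∀ g, ((ψ.1 g : geomTorsion W' (((3 : ℕ) : ℤ) ^ j * ((3 : ℕ) : ℤ))) : geomPoints W') =
          TateModule.proj 3 (j + 1) (φ₁.1 g)) →
        Ψ (oneCocycleClass _ φ₁) = oneCocycleClass _ ψ) →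
    ∀ (y : H1 (tateRep W' 3) (cycSubgroup 3 0 r))
      (κ₀ : galoisCohomology (WeierstrassCurve.torsionGaloisModule W' (((3 : ℕ) : ℤ) ^ j * ((3 : ℕ) : ℤ))) 1)
      (h : (tateLocalRep W' 3 (Sum.inr v')).cohomology 1),
      resSubgroup (WeierstrassCurve.torsionGaloisModule W' (((3 : ℕ) : ℤ) ^ j * ((3 : ℕ) : ℤ))).toTopRep
          (cycSubgroup 3 0 r) 1 κ₀ = Ψ y →
      galoisCohomology.localization (WeierstrassCurve.torsionGaloisModule W' (((3 : ℕ) : ℤ) ^ j * ((3 : ℕ) : ℤ)))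
          (Sum.inr v') 1 κ₀ = tateLocalMap W' 3 j (Sum.inr v') h →
      ∃ l ∈ cycIntLattice 3 (cycLevel 3 0 r),
        (((3 : ℕ) : ℤ_[3]) ^ (0 : ℕ)) • ((φ0 h ⊗ₜ[ℚ] (1 : CyclotomicField (cycLevel 3 0 r) ℚ)) - Λ' 0 r y) =
          (((3 : ℕ) : ℤ_[3]) ^ (j + 1)) • (l : ℚ_[3] ⊗[ℚ] CyclotomicField (cycLevel 3 0 r) ℚ)

/-- Local notation: **(C1ₑₓ¹ᵘ) at the row `(W, v, P)`** — seat w2-c3's DEFINED-KATO package (C1ₑₓ) with the crude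
exponent FIXED to `b = 1` and R-κ added: `(ι, κK, Λ, φ)` with `κK ≠ 0` a rational `3`-adic unit, `hker`, `hdual`,
COMPAT₁ at every depth, and Kato's `ZetaBody` family for `P.f`. -/
local notation3 (prettyPrint := false) "DEFKATO₁ᵘ⟦" W' ", " v' ", " N' ", " P' "⟧" =>
  ∃ (ι : (n : ℕ) → (CyclotomicField n ℚ →+* ℂ)) (κK : ℝ)
    (Λ : ∀ (k' : ℕ) (r : Finset (HeightOneSpectrum (𝓞 ℚ))),
      H1 (tateRep W' 3) (cycSubgroup 3 k' r) →ₗ[ℤ_[3]] ℚ_[3] ⊗[ℚ] CyclotomicField (cycLevel 3 k' r) ℚ)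
    (φ : (tateLocalRep W' 3 (Sum.inr v')).cohomology 1 →+ ℚ_[3]),
    κK ≠ 0 ∧ (∃ u : ℚ, (u : ℝ) = κK ∧ padicValRat 3 u = 0) ∧
    (∀ y, φ y = 0 ↔ ∀ j : ℕ, tateLocalMap W' 3 j (Sum.inr v') y ∈
      WeierstrassCurve.kummerSelmerStructure W' (((3 : ℕ) : ℤ) ^ j * ((3 : ℕ) : ℤ)) (Sum.inr v')) ∧
    (∀ a : ℚ_[3], (∃ y, φ y = a) ↔
      ∀ Q : ((W' : WeierstrassCurve ℚ).baseChange ℚ_[3]).toAffine.Point,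
        ‖a * padicLog ((W' : WeierstrassCurve ℚ).baseChange ℚ_[3]) Q‖ ≤ 1) ∧
    (∀ j : ℕ, COMPAT₁⟦W', j, v', Λ, φ⟧) ∧
    ∀ (c d a : ℤ) (A : ℕ), 0 < A → Int.gcd c (6 * 3 * A) = 1 → Int.gcd d (6 * 3 * N') = 1 →
      ∃ (z : ∀ (k' : ℕ) (r : (cyclotomicLevelsRat 3 (badPlaces c d A N')).Ideals),
            H1 (tateRep W' 3) ((cyclotomicLevelsRat 3 (badPlaces c d A N')).level k' r.1))
        (x : ∀ (k' : ℕ) (r : (cyclotomicLevelsRat 3 (badPlaces c d A N')).Ideals),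
            CyclotomicField (cycLevel 3 k' r.1) ℚ),
        ZetaBody W' 3 (P' : ModularParametrizationData W' N').f ι κK Λ c d a A z x

/-- Local notation: **(C1ₑₓ^τ) at the row `(W, v, P)` with integer model `t₃` of `a₃`** — the DEFINED-KATO package with the
TWISTED (Euler-factor) compatibility: `(ι, κK, Λ, φ)` with `κK ≠ 0` a rational `3`-adic unit, `hker`, `hdual`, COMPAT_τ at
every depth, and Kato's `ZetaBody` family for `P.f`. -/
local notation3 (prettyPrint := false) "DEFKATOτ⟦" W' ", " v' ", " N' ", " P' ", " t3 "⟧" =>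
  ∃ (ι : (n : ℕ) → (CyclotomicField n ℚ →+* ℂ)) (κK : ℝ)
    (Λ : ∀ (k' : ℕ) (r : Finset (HeightOneSpectrum (𝓞 ℚ))),
      H1 (tateRep W' 3) (cycSubgroup 3 k' r) →ₗ[ℤ_[3]] ℚ_[3] ⊗[ℚ] CyclotomicField (cycLevel 3 k' r) ℚ)
    (φ : (tateLocalRep W' 3 (Sum.inr v')).cohomology 1 →+ ℚ_[3]),
    κK ≠ 0 ∧ (∃ u : ℚ, (u : ℝ) = κK ∧ padicValRat 3 u = 0) ∧
    (∀ y, φ y = 0 ↔ ∀ j : ℕ, tateLocalMap W' 3 j (Sum.inr v') y ∈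
      WeierstrassCurve.kummerSelmerStructure W' (((3 : ℕ) : ℤ) ^ j * ((3 : ℕ) : ℤ)) (Sum.inr v')) ∧
    (∀ a : ℚ_[3], (∃ y, φ y = a) ↔
      ∀ Q : ((W' : WeierstrassCurve ℚ).baseChange ℚ_[3]).toAffine.Point,
        ‖a * padicLog ((W' : WeierstrassCurve ℚ).baseChange ℚ_[3]) Q‖ ≤ 1) ∧
    (∀ j : ℕ, COMPATτ⟦W', j, v', t3, Λ, φ⟧) ∧
    ZBODY⟦W', N', (P' : ModularParametrizationData W' N').f, ι, κK, Λ⟧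

/-- Local notation: **(C1ₑₓ⁰ᵘ) at the row `(W, v, P)`** — the DEFINED-KATO package with the EXACT compatibility `b = 0`
and R-κ. -/
local notation3 (prettyPrint := false) "DEFKATO₀ᵘ⟦" W' ", " v' ", " N' ", " P' "⟧" =>
  ∃ (ι : (n : ℕ) → (CyclotomicField n ℚ →+* ℂ)) (κK : ℝ)
    (Λ : ∀ (k' : ℕ) (r : Finset (HeightOneSpectrum (𝓞 ℚ))),
      H1 (tateRep W' 3) (cycSubgroup 3 k' r) →ₗ[ℤ_[3]] ℚ_[3] ⊗[ℚ] CyclotomicField (cycLevel 3 k' r) ℚ)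
    (φ : (tateLocalRep W' 3 (Sum.inr v')).cohomology 1 →+ ℚ_[3]),
    κK ≠ 0 ∧ (∃ u : ℚ, (u : ℝ) = κK ∧ padicValRat 3 u = 0) ∧
    (∀ y, φ y = 0 ↔ ∀ j : ℕ, tateLocalMap W' 3 j (Sum.inr v') y ∈
      WeierstrassCurve.kummerSelmerStructure W' (((3 : ℕ) : ℤ) ^ j * ((3 : ℕ) : ℤ)) (Sum.inr v')) ∧
    (∀ a : ℚ_[3], (∃ y, φ y = a) ↔
      ∀ Q : ((W' : WeierstrassCurve ℚ).baseChange ℚ_[3]).toAffine.Point,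
        ‖a * padicLog ((W' : WeierstrassCurve ℚ).baseChange ℚ_[3]) Q‖ ≤ 1) ∧
    (∀ j : ℕ, COMPAT₀⟦W', j, v', Λ, φ⟧) ∧
    ZBODY⟦W', N', (P' : ModularParametrizationData W' N').f, ι, κK, Λ⟧

/-- Local notation: **(C1₂) at the row `(W, v, P)`** — seat acc3's two-exponent fine Kato package (FINEKATO₂'s row
text). -/
local notation3 (prettyPrint := false) "FINEKATO₂⟦" W' ", " v' ", " N' ", " P' "⟧" =>
  ∃ (ι : (n : ℕ) → (CyclotomicField n ℚ →+* ℂ)) (κK : ℝ)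
    (Λ : ∀ (k' : ℕ) (r : Finset (HeightOneSpectrum (𝓞 ℚ))),
      H1 (tateRep W' 3) (cycSubgroup 3 k' r) →ₗ[ℤ_[3]]
        ℚ_[3] ⊗[ℚ] CyclotomicField (cycLevel 3 k' r) ℚ)
    (Λfin : ∀ j : ℕ, galoisCohomology
      ((WeierstrassCurve.torsionGaloisModule W' (((3 : ℕ) : ℤ) ^ j * ((3 : ℕ) : ℤ))).toLocal (Sum.inr v')) 1 →+
        ZMod (3 ^ (j + 1))) (e : ℕ),
    κK ≠ 0 ∧ (∃ u : ℚ, (u : ℝ) = κK ∧ padicValRat 3 u = 0) ∧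
    (LAMBDA⟦W', v', Λfin⟧) ∧
    (∀ j : ℕ, RIDER₂⟦W', j, 0, e, v', Λ, Λfin j⟧) ∧
    ZBODY⟦W', N', (P' : ModularParametrizationData W' N').f, ι, κK, Λ⟧

/-- Local notation: **(C1ₑₓ¹ᵘ) ON THE MULTIPLICATIVE ROWS** (binders of `stub_nonAdditive` + `Mult W₀ 3`). -/
local notation3 (prettyPrint := false) "PKG_EX1U_MULT" =>
  ∀ (W₀ : WeierstrassCurve ℚ) [W₀.IsElliptic] [W₀.IsGloballyMinimal],
    (∀ n : ℕ, W₀.HasSurjectiveModNGaloisRep (3 ^ n : ℕ)) →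
    Nat.card {Q : (W₀.baseChange ℚ_[3]).toAffine.Point // (3 : ℕ) • Q = 0} = 1 →
    ∀ {N : ℕ} [NeZero N], N = W₀.conductorNorm ℤ →
    ∀ (D₀ : ModularParametrizationData W₀ N),
      (∀ z ∈ D₀.L.lattice, ∃ w ∈ periodLattice D₀.f, z = D₀.c * w) →
      (∀ (W₂ : WeierstrassCurve ℚ) [W₂.IsElliptic] (D₂ : ModularParametrizationData W₂ N),
        D₂.f = D₀.f → D₀.modularDegree ≤ D₂.modularDegree) →
      W₀.HasMultiplicativeReductionAtPrime 3 →
    ∀ (v₃ : HeightOneSpectrum (𝓞 ℚ)), ((3 : ℕ) : 𝓞 ℚ) ∈ v₃.asIdeal →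
    ∀ [ContinuousSMul ℤ_[3] (WeierstrassCurve.tateModule W₀ 3)] [Module.Free ℤ_[3] (WeierstrassCurve.tateModule W₀ 3)]
      [Module.Finite ℤ_[3] (WeierstrassCurve.tateModule W₀ 3)],
      DEFKATO₁ᵘ⟦W₀, v₃, N, D₀⟧

/-- Local notation: **(C1ₑₓ^τ) ON THE GOOD ROWS** (binders of `stub_nonAdditive` + `3 ∤ N` + an integer model `t₃` of
`a₃`). -/
local notation3 (prettyPrint := false) "PKG_EXτ_GOOD" =>
  ∀ (W₀ : WeierstrassCurve ℚ) [W₀.IsElliptic] [W₀.IsGloballyMinimal],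
    (∀ n : ℕ, W₀.HasSurjectiveModNGaloisRep (3 ^ n : ℕ)) →
    Nat.card {Q : (W₀.baseChange ℚ_[3]).toAffine.Point // (3 : ℕ) • Q = 0} = 1 →
    ∀ {N : ℕ} [NeZero N], N = W₀.conductorNorm ℤ →
    ∀ (D₀ : ModularParametrizationData W₀ N),
      (∀ z ∈ D₀.L.lattice, ∃ w ∈ periodLattice D₀.f, z = D₀.c * w) →
      (∀ (W₂ : WeierstrassCurve ℚ) [W₂.IsElliptic] (D₂ : ModularParametrizationData W₂ N),
        D₂.f = D₀.f → D₀.modularDegree ≤ D₂.modularDegree) →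
      ¬ 3 ∣ N →
    ∀ (v₃ : HeightOneSpectrum (𝓞 ℚ)), ((3 : ℕ) : 𝓞 ℚ) ∈ v₃.asIdeal →
    ∀ (t₃ : ℤ), cuspCoeff D₀.f 3 = t₃ →
    ∀ [ContinuousSMul ℤ_[3] (WeierstrassCurve.tateModule W₀ 3)] [Module.Free ℤ_[3] (WeierstrassCurve.tateModule W₀ 3)]
      [Module.Finite ℤ_[3] (WeierstrassCurve.tateModule W₀ 3)],
      DEFKATOτ⟦W₀, v₃, N, D₀, t₃⟧

/-- Local notation: **(C1ₑₓ⁰ᵘ) ON THE ADDITIVE ROWS WITH `3 ∤ c_P`** (binders of acc3's PKG₂ with the defect disjunction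
replaced by `3 ∤ c_P`; the Kato stratum is included). -/
local notation3 (prettyPrint := false) "PKG_EX0U_ADD" =>
  ∀ (W : WeierstrassCurve ℚ) [W.IsElliptic] [W.IsGloballyMinimal]
    [ContinuousSMul ℤ_[3] (W.tateModule 3)] [Module.Free ℤ_[3] (W.tateModule 3)]
    [Module.Finite ℤ_[3] (W.tateModule 3)],
    (∀ m : ℕ, W.HasSurjectiveModNGaloisRep (3 ^ m : ℕ)) →
    (haveI : Fact (Nat.Prime 3) := ⟨Nat.prime_three⟩; Addv W 3) →
    Nat.card {Q : (W.baseChange ℚ_[3]).toAffine.Point // (3 : ℕ) • Q = 0} = 1 →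
    ∀ (v₃ : HeightOneSpectrum (𝓞 ℚ)), ((3 : ℕ) : 𝓞 ℚ) ∈ v₃.asIdeal →
    ∀ {N : ℕ} [NeZero N] (P : ModularParametrizationData W N), N = W.conductorNorm ℤ →
      (∀ z ∈ P.L.lattice, ∃ w ∈ periodLattice P.f, z = P.c * w) →
      ¬ (3 : ℤ) ∣ P.maninConstant →
      DEFKATO₀ᵘ⟦W, v₃, N, P⟧

/-- Local notation: **(C1₂) ON THE MANIN ROWS** (acc3's PKG₂ with the defect disjunction replaced by `3 ∣ c_P`). -/
local notation3 (prettyPrint := false) "PKG₂_MANIN" =>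
  ∀ (W : WeierstrassCurve ℚ) [W.IsElliptic] [W.IsGloballyMinimal]
    [ContinuousSMul ℤ_[3] (W.tateModule 3)] [Module.Free ℤ_[3] (W.tateModule 3)]
    [Module.Finite ℤ_[3] (W.tateModule 3)],
    (∀ m : ℕ, W.HasSurjectiveModNGaloisRep (3 ^ m : ℕ)) →
    (haveI : Fact (Nat.Prime 3) := ⟨Nat.prime_three⟩; Addv W 3) →
    Nat.card {Q : (W.baseChange ℚ_[3]).toAffine.Point // (3 : ℕ) • Q = 0} = 1 →
    ∀ (v₃ : HeightOneSpectrum (𝓞 ℚ)), ((3 : ℕ) : 𝓞 ℚ) ∈ v₃.asIdeal →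
    ∀ {N : ℕ} [NeZero N] (P : ModularParametrizationData W N), N = W.conductorNorm ℤ →
      (∀ z ∈ P.L.lattice, ∃ w ∈ periodLattice P.f, z = P.c * w) →
      (3 : ℤ) ∣ P.maninConstant →
      FINEKATO₂⟦W, v₃, N, P⟧

/-- Local notation: kim3's FINE KATO PACKAGE (C1) at a Kato-stratum row (the `hC1` text of seat w2-c3's
`katoKuriharaPortThreeShared_of_fineKato`, inner `∃`). -/
local notation3 (prettyPrint := false) "FINEKATO⟦" W' ", " v' ", " N' ", " P' "⟧" =>
  ∃ (ι : (n : ℕ) → (CyclotomicField n ℚ →+* ℂ)) (κK : ℝ)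
    (Λ : ∀ (k' : ℕ) (r : Finset (HeightOneSpectrum (𝓞 ℚ))),
      H1 (tateRep W' 3) (cycSubgroup 3 k' r) →ₗ[ℤ_[3]]
        ℚ_[3] ⊗[ℚ] CyclotomicField (cycLevel 3 k' r) ℚ)
    (Λfin : ∀ j : ℕ, galoisCohomology
      ((WeierstrassCurve.torsionGaloisModule W' (((3 : ℕ) : ℤ) ^ j * ((3 : ℕ) : ℤ))).toLocal (Sum.inr v')) 1 →+
        ZMod (3 ^ (j + 1))),
    κK ≠ 0 ∧ (∃ u : ℚ, (u : ℝ) = κK ∧ padicValRat 3 u = 0) ∧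
    (∀ j : ℕ, KatoExpStarFiniteLevelAt W' 3 j 0 v' Λ (Λfin j)) ∧
    ZBODY⟦W', N', (P' : ModularParametrizationData W' N').f, ι, κK, Λ⟧

section Bookkeeping
variable (W : WeierstrassCurve ℚ) [W.IsElliptic] [ContinuousSMul ℤ_[3] (W.tateModule 3)]

/-- n1011's exponent-`0` rider ⟸ the (Λ)-clauses ∧ RIDER₂ at `(0, 0)`. [folklore] -/
theorem katoExpStarFiniteLevelAt_of_rider₂_zero {j : ℕ} {v : HeightOneSpectrum (𝓞 ℚ)}
    {Λ : ∀ (k' : ℕ) (r : Finset (HeightOneSpectrum (𝓞 ℚ))),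
      H1 (tateRep W 3) (cycSubgroup 3 k' r) →ₗ[ℤ_[3]] ℚ_[3] ⊗[ℚ] CyclotomicField (cycLevel 3 k' r) ℚ}
    {Λf : galoisCohomology ((W.torsionGaloisModule (((3 : ℕ) : ℤ) ^ j * ((3 : ℕ) : ℤ))).toLocal
      (Sum.inr v)) 1 →+ ZMod (3 ^ (j + 1))}
    (hΛa : ∀ c : ZMod (3 ^ (j + 1)), ∃ x ∈ propagatedSelmerStructure W 3 j (Sum.inr v), Λf x = c)
    (hΛb : ∀ x ∈ propagatedSelmerStructure W 3 j (Sum.inr v),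
      Λf x = 0 ↔ x ∈ W.kummerSelmerStructure (((3 : ℕ) : ℤ) ^ j * ((3 : ℕ) : ℤ)) (Sum.inr v))
    (h : RIDER₂⟦W, j, 0, 0, v, Λ, Λf⟧) :
    KatoExpStarFiniteLevelAt W 3 j 0 v Λ Λf := by
  refine ⟨hΛa, hΛb, fun r Ψ hΨ y κ₀ s hres hloc hval => ?_⟩
  have h' := h r Ψ hΨ y κ₀ s hres hloc (by simpa using hval)
  simpa using h'

end Bookkeeping
section KatoStratum
variable (W : WeierstrassCurve ℚ) [W.IsElliptic] [W.IsGloballyMinimal]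

set_option backward.isDefEq.respectTransparency false in
/-- **(C1ₑₓ⁰ᵘ) ⟹ (C1) on a Kato-stratum row** (`Addv`, `3 ∤ c₃`, `t = 0`): `φ` is already normalised (`v₃(c₃) = 0`) and
`rider₂_of_compat` at `(0,0,0)` gives n1011's exponent-`0` rider — a unit-trace-free road into 19560's package. Nothing booked.
[cite: Kim2022StructureSelmer, §3.2.3, Lemma 3.9, Thm. 3.13] [cite: BlochKato1990, §3 (Prop. 3.8, Ex. 3.11)] -/
theorem fineKato_of_definedKatoExact_katoStratum
    [ContinuousSMul ℤ_[3] (W.tateModule 3)] [Module.Free ℤ_[3] (W.tateModule 3)] [Module.Finite ℤ_[3] (W.tateModule 3)]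
    {N : ℕ} [NeZero N] (P : ModularParametrizationData W N)
    (hng : ¬ W.HasGoodReductionAtPrime 3) (hnm : ¬ W.HasMultiplicativeReductionAtPrime 3)
    (hc3 : ¬ 3 ∣ (W.baseChange ℚ_[3]).localTamagawaNumber ℤ_[3])
    {v₃ : HeightOneSpectrum (𝓞 ℚ)}
    (ht : Nat.card {Q : (W.baseChange ℚ_[3]).toAffine.Point // (3 : ℕ) • Q = 0} = 1)
    (hKU : DEFKATO₀ᵘ⟦W, v₃, N, P⟧) :
    FINEKATO⟦W, v₃, N, P⟧ := by
  obtain ⟨ι, κK, Λ, φ, hκ0, hunit, hker, hdual, hcompat, hz⟩ := hKU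
  obtain ⟨φ', hint', hsurj', hφ⟩ := exists_normalised_of_dual_of_additive W (Sum.inr v₃) φ hdual ht hng hnm
  have hv0 : padicValNat 3 ((W.baseChange ℚ_[3]).localTamagawaNumber ℤ_[3]) = 0 :=
    padicValNat.eq_zero_of_not_dvd hc3
  rw [hv0] at hφ
  have hc : (3 : ℚ_[3]) ^ (((0 : ℕ) : ℕ) : ℤ) ≠ 0 := zpow_ne_zero _ (by norm_num)
  have hker' := hker_of_eq_mul W 3 (Sum.inr v₃) φ hc hφ hker
  obtain ⟨Λfin, hΛ, hI⟩ := exists_finLevelFunctional_clauses_of_normalised W 3 (Sum.inr v₃) φ' hint' hsurj' hker'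
  have he : ((0 : ℕ) : ℤ) = ((0 : ℕ) : ℤ) + ((0 : ℕ) : ℤ) + (((0 : ℕ) : ℕ) : ℤ) := by norm_num
  have hrid : ∀ j : ℕ, KatoExpStarFiniteLevelAt W 3 j 0 v₃ Λ (Λfin j) := fun j =>
    katoExpStarFiniteLevelAt_of_rider₂_zero W (hΛ j).1 (hΛ j).2
      (rider₂_of_smul_zero W
        (rider₂_of_compat W v₃ Λ φ φ' (((0 : ℕ) : ℕ) : ℤ) hφ hint' j (Λfin j) (hI j) 0 (hcompat j) 0 0 0 le_rfl he))
  exact ⟨ι, κK, Λ, Λfin, hκ0, hunit, hrid, hz⟩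

/-- **Crux 19560 BY NAME ⟸ (C1ₑₓ⁰ᵘ) on the additive `t = 0` rows with `3 ∤ c_P`** (w2-c3's `katoKuriharaPortThreeShared_of_fineKato`
on §2).  CONDITIONAL; 19560 is NOT closed by this. [cite: Kato2004Asterisque, §9.4, Thm. 9.7 (p. 189), Ex. 13.3]
[cite: MazurRubin2004, Thm. 3.2.4 and App. A Remark A.5] -/
theorem katoKuriharaPortThreeShared_of_definedKatoExact (hEXa : PKG_EX0U_ADD) : KatoKuriharaPortThreeShared := by
  refine KimAtThreeDeepUpperPortSharedOfFineKato.katoKuriharaPortThreeShared_of_fineKato ?_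
  intro W _ _ _ _ _ htow hA hc3 ht v₃ hv₃ N _ P hN hlat hman
  exact fineKato_of_definedKatoExact_katoStratum W P hA.1 hA.2 hc3 ht (hEXa W htow hA ht v₃ hv₃ P hN hlat hman)

end KatoStratum
/-- **Crux 19077 BY NAME ⟸ the four published leaves ∧ (C1ₑₓ¹ᵘ)[mult] ∧ (C1ₑₓ^τ)[good] ∧ (C1ₑₓ⁰ᵘ)[additive, 3 ∤ c_P] ∧
(C1₂)[Manin]** — NO crux hypothesis (19560 DERIVED, §2).  CONDITIONAL; nothing booked. [cite: Kim2025RefinedTNC, Thm 1.2]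
[cite: Sakamoto2024, Thm. 4.4 (p. 926)] [cite: MazurRubin2004, Thm. 5.2.12] [cite: Carayol1986] -/
theorem shallowEqDeepAtTorsionFree_of_leaves_of_definedKato_noPort
    (hSak : SakamotoKolyvaginThree) (hGZK : RankEqAnalyticRankLeOne) (hPT : PoitouTateSelmerDuality)
    (hlev : CarayolLevelEqConductor)
    (hEXm : PKG_EX1U_MULT) (hEXg : PKG_EXτ_GOOD) (hEXa : PKG_EX0U_ADD) (hManin : PKG₂_MANIN) :
    ShallowEqDeepAtTorsionFree :=
  shallowEqDeepAtTorsionFree_of_leaves_of_definedKato_final hSak hGZK hPT hlev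
    (katoKuriharaPortThreeShared_of_definedKatoExact hEXa) hEXm hEXg hEXa hManin

end Summit.BirchSwinnertonDyer.BirchSwinnertonDyer.Theorems.KimAtThreeShallowEqDeepKatoStratumOfDefinedKato

end
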